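import Summits.AtomisticToContinuum.HydrodynamicLimit.Theorems.CollisionIsometryCLTCollisionalTransferLocalityFluxFormKinematics
import Summits.AtomisticToContinuum.HydrodynamicLimit.Theorems.CollisionIsometryCLTCollisionalTransferLocalityBlockFields
import Summits.AtomisticToContinuum.HydrodynamicLimit.Theorems.CollisionIsometryCLTCollisionalTransferLocalityBalanceIdentity
import Literature.Analysis.FunctionSpaces.TorusDerivBounds
import Literature.MathematicalPhysics.KineticTheory.HardSphereCanonicalTorus
import HarnessLib

/-!
# [A'-kin], part 2: the flux form of the collision-jump sum and the reduction [A'] ⟸ [V] ∧ [A'-chaos]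
(line `hemisphere-affine-slaving`, crux `CollisionalTransferLocality`, stmt-AtomisticToContinuum-9518)

Helper file (`--supports stmt-AtomisticToContinuum-9518`; registered stub `fluxMomentChaos_of_parts`) of the line lead
(gen 1, seat c2).

* `abs_pairJump_sub_pairMark_le` — THE TAYLOR STEP AT ONE COLLISION: for an ordered contact pair (`‖x_i − x_j‖ = ε_N < 1/2`)
  in an OUTGOING configuration, with the slices `ψ s`, `χ s` smooth and all second partials `≤ C₂`:
  `|(jumpK ij + jumpK ji) − (markK ij + markK ji)| ≤ 27 C₂ ε_N · virialK ij` (`virialK = ε_N ‖Δv_i‖ (1 + ‖v_i‖ + ‖v_j‖)`);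
* `abs_Jfun_sub_Mfun_le` — THE PATHWISE FLUX FORM on the good set: `|J_N(z, τ) − M_N(z, τ)| ≤ 27 C₂ ε_N · V_N(z, τ)`
  (binary collisions, the two orders of each colliding pair, outgoing post-collisional configurations);
* `virialW_mono`, `exists_second_deriv_bound` (uniform second-derivative bounds of the tests on `[0, t]`, from
  `exists_hasDerivBounds_of_isSmoothSpaceTimeOn`);
* `fluxMomentChaos_of_parts` (registered) — [V] `VirialBounded` ∧ [A'-chaos] `FluxFormChaos` ⟹ [A'] `FluxMomentChaos`
  (`ε_N → 0`, tightness, union bound off the null bad set).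
References: Spohn (1991) Part I §3.2 (3.8)–(3.10); Chapman–Cowling (1970) §16.4 (the `ε(ω·∇)ψ` Taylor step of the
collisional transfer).
-/

namespace Summit.AtomisticToContinuum.HydrodynamicLimit.Theorems.HemisphereAffineSlaving

open scoped BigOperators Topology Classical ENNReal InnerProductSpace
open Filter Set Function MeasureTheory
open Literature.Analysis.FunctionSpaces Literature.Analysis.FluidPDE

noncomputable section

open Literature.MathematicalPhysics.KineticTheory (T3 V3 hsDiameter hsDiameter_pos localGibbsLaw tendsto_hsDiameter)

/-! ## The Taylor step at one collision -/

section OneCollision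

/-- Components of the torus gradient are the partial derivatives (for `C¹` scalars). -/
theorem gradient_apply_eq_partialDeriv {f : T3 → ℝ} (hf : Torus.IsContDiff 1 f) (x : T3) (a : Fin 3) :
    Torus.gradient f x a = Torus.partialDeriv a f x := by
  rw [Torus.gradient_eq_sum_partialDeriv hf]
  simp only [WithLp.ofLp_sum, WithLp.ofLp_smul, Finset.sum_apply, Pi.smul_apply, smul_eq_mul]
  rw [Finset.sum_eq_single a]
  · simp
  · intro b _ hb
    simp [Ne.symm hb]
  · simp

/-- The symmetric Taylor estimate in gradient components. -/
theorem abs_sym_taylor_grad_le {f : T3 → ℝ} (hf : Torus.IsSmooth f) {C₂ : ℝ}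
    (hC : ∀ a b y, |Torus.partialDeriv a (Torus.partialDeriv b f) y| ≤ C₂) (x : T3) (n : V3) :
    |2 * (f (x + Torus.proj n) - f x) -
        ∑ a, n a * (Torus.gradient f (x + Torus.proj n) a + Torus.gradient f x a)| ≤
      2 * C₂ * (∑ a, |n a|) ^ 2 := by
  have hf1 : Torus.IsContDiff 1 f := hf.isContDiff (by simp)
  simp only [gradient_apply_eq_partialDeriv hf1]
  exact abs_sym_taylor_le hf hC x n

/-- `Σ_a |n_a| ≤ 3 ‖n‖` on `ℝ³`. -/
theorem sum_abs_le_three_mul_norm (n : V3) : ∑ a, |n a| ≤ 3 * ‖n‖ := by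
  calc ∑ a, |n a| ≤ ∑ _a : Fin 3, ‖n‖ := Finset.sum_le_sum fun a _ => by
          rw [← Real.norm_eq_abs]; exact PiLp.norm_apply_le n a
    _ = 3 * ‖n‖ := by simp

/-- **The Taylor step at one collision.** For an ordered pair `(i, j)` at contact (`‖x_i − x_j‖ = ε_N`,
`ε_N < 1/2`) in an OUTGOING configuration, with the slices `ψ s`, `χ s` smooth and all their second
partial derivatives bounded by `C₂`: the jump of the pair minus its flux-form mark is at most
`27 C₂ ε_N` times the pair's weighted virial kernel `ε_N ‖Δv_i‖ (1 + ‖v_i‖ + ‖v_j‖)`. -/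
theorem abs_pairJump_sub_pairMark_le {σ : ℝ} {N : ℕ} {w : Cfg N} {i j : Fin (N + 1)}
    (hcontact : ‖sepV N w i j‖ = hsDiameter σ N) (hεpos : 0 < hsDiameter σ N)
    (hεhalf : hsDiameter σ N < 2⁻¹) (hout : 0 < ⟪sepV N w i j, (w i).2 - (w j).2⟫_ℝ)
    {ψ : ℝ → T3 → V3} {χ : ℝ → T3 → ℝ} {s : ℝ} (hψ : ∀ a, Torus.IsSmooth fun y => ψ s y a)
    (hχ : Torus.IsSmooth (χ s)) {C₂ : ℝ}
    (hCψ : ∀ a c e y, |Torus.partialDeriv c (Torus.partialDeriv e fun y => ψ s y a) y| ≤ C₂)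
    (hCχ : ∀ c e y, |Torus.partialDeriv c (Torus.partialDeriv e (χ s)) y| ≤ C₂) :
    |(jumpK ψ χ N s w i j + jumpK ψ χ N s w j i) - (markK σ ψ χ N s w i j + markK σ ψ χ N s w j i)| ≤
      27 * C₂ * hsDiameter σ N * virialK σ N s w i j := by
  set ε : ℝ := hsDiameter σ N with hεdef
  set n : V3 := sepV N w i j with hndef
  have hlt : ‖sepV N w i j‖ < 2⁻¹ := by rw [hcontact]; exact hεhalf
  have hn0 : n ≠ 0 := by
    intro h; rw [h, norm_zero] at hcontact; exact hεpos.ne hcontact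
  have hC0 : 0 ≤ C₂ := (abs_nonneg _).trans (hCχ 0 0 (w i).1)
  -- the unit normal and the normal relative speed
  have hω : omg N w i j = ε⁻¹ • n := by rw [omg, ← hndef, hcontact]
  set c : ℝ := ⟪(w i).2 - (w j).2, omg N w i j⟫_ℝ with hcdef
  have hc_eq : c = ε⁻¹ * ⟪n, (w i).2 - (w j).2⟫_ℝ := by
    rw [hcdef, hω, inner_smul_right, real_inner_comm]
  have hcpos : 0 < c := by rw [hc_eq]; exact mul_pos (inv_pos.2 hεpos) hout
  have hdv : ‖dV N w i j‖ = c := by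
    rw [norm_dV_eq (by exact hn0), ← hcdef, abs_of_pos hcpos]
  -- positions
  have hx : (w i).1 = (w j).1 + Torus.proj n := fst_eq_fst_add_proj_sepV w i j
  -- the symmetric Taylor remainders
  set Dψ : Fin 3 → ℝ := fun a => 2 * (ψ s (w i).1 a - ψ s (w j).1 a) -
    ∑ b, n b * (gradPsi ψ s (w i).1 a b + gradPsi ψ s (w j).1 a b) with hDψ
  set Dχ : ℝ := 2 * (χ s (w i).1 - χ s (w j).1) -
    ∑ a, n a * (gradChi χ s (w i).1 a + gradChi χ s (w j).1 a) with hDχ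
  set S : ℝ := ∑ a, |n a| with hSdef
  have hS0 : 0 ≤ S := Finset.sum_nonneg fun a _ => abs_nonneg _
  have hS3 : S ≤ 3 * ε := by rw [hSdef, ← hcontact]; exact sum_abs_le_three_mul_norm n
  have hDψ_le : ∀ a, |Dψ a| ≤ 2 * C₂ * S ^ 2 := by
    intro a
    have h := abs_sym_taylor_grad_le (hψ a) (hCψ a) (w j).1 n
    rw [← hx] at h
    simpa only [hDψ, gradPsi] using h
  have hDχ_le : |Dχ| ≤ 2 * C₂ * S ^ 2 := by
    have h := abs_sym_taylor_grad_le hχ hCχ (w j).1 n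
    rw [← hx] at h
    simpa only [hDχ, gradChi] using h
  -- the algebraic identity: jump − mark = c (ε⁻¹ (1/2) Σ_a n_a Dψ_a + ⟪V, ω⟫ (1/2) Dχ)
  have hid : (jumpK ψ χ N s w i j + jumpK ψ χ N s w j i) -
      (markK σ ψ χ N s w i j + markK σ ψ χ N s w j i) =
      c * (ε⁻¹ * ((1 / 2) * ∑ a, n a * Dψ a) + ⟪Vcm N w i j, omg N w i j⟫_ℝ * ((1 / 2) * Dχ)) := by
    rw [jumpK_add_jumpK_swap hlt, markK_add_markK_swap hlt, hdv, ← hcdef, ← hεdef, hω, hDψ, hDχ]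
    have hε0 : ε ≠ 0 := hεpos.ne'
    simp only [inner_smul_right, PiLp.smul_apply, smul_eq_mul, PiLp.inner_apply, PiLp.sub_apply,
      RCLike.inner_apply, conj_trivial, Fin.sum_univ_three]
    field_simp
    ring
  -- bounds
  have hV : |⟪Vcm N w i j, omg N w i j⟫_ℝ| ≤ ‖(w i).2‖ + ‖(w j).2‖ := by
    calc |⟪Vcm N w i j, omg N w i j⟫_ℝ| ≤ ‖Vcm N w i j‖ * ‖omg N w i j‖ := abs_real_inner_le_norm _ _
      _ = ‖Vcm N w i j‖ := by rw [norm_omg (by exact hn0), mul_one]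
      _ ≤ 1 / 2 * (‖(w i).2‖ + ‖(w j).2‖) := by
          rw [Vcm, norm_smul, Real.norm_eq_abs, abs_of_pos (by norm_num : (0 : ℝ) < 1 / 2)]
          exact mul_le_mul_of_nonneg_left (norm_add_le _ _) (by norm_num)
      _ ≤ ‖(w i).2‖ + ‖(w j).2‖ := by linarith [norm_nonneg (w i).2, norm_nonneg (w j).2]
  have h1 : |ε⁻¹ * ((1 / 2) * ∑ a, n a * Dψ a)| ≤ 27 * C₂ * ε ^ 2 := by
    have hsum : |∑ a, n a * Dψ a| ≤ S * (2 * C₂ * S ^ 2) := by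
      calc |∑ a, n a * Dψ a| ≤ ∑ a, |n a * Dψ a| := Finset.abs_sum_le_sum_abs _ _
        _ ≤ ∑ a, |n a| * (2 * C₂ * S ^ 2) := Finset.sum_le_sum fun a _ => by
            rw [abs_mul]; exact mul_le_mul_of_nonneg_left (hDψ_le a) (abs_nonneg _)
        _ = S * (2 * C₂ * S ^ 2) := by rw [← Finset.sum_mul]
    rw [abs_mul, abs_mul, abs_of_pos (inv_pos.2 hεpos), abs_of_pos (by norm_num : (0 : ℝ) < 1 / 2)]
    calc ε⁻¹ * (1 / 2 * |∑ a, n a * Dψ a|) ≤ ε⁻¹ * (1 / 2 * (S * (2 * C₂ * S ^ 2))) := by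
          gcongr
      _ = ε⁻¹ * (C₂ * S ^ 3) := by ring
      _ ≤ ε⁻¹ * (C₂ * (3 * ε) ^ 3) := by gcongr
      _ = 27 * C₂ * ε ^ 2 := by field_simp; ring
  have h2 : |⟪Vcm N w i j, omg N w i j⟫_ℝ * ((1 / 2) * Dχ)| ≤ (‖(w i).2‖ + ‖(w j).2‖) * (9 * C₂ * ε ^ 2) := by
    rw [abs_mul, abs_mul, abs_of_pos (by norm_num : (0 : ℝ) < 1 / 2)]
    refine mul_le_mul hV ?_ (by positivity) (by positivity)
    calc 1 / 2 * |Dχ| ≤ 1 / 2 * (2 * C₂ * S ^ 2) := by gcongr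
      _ = C₂ * S ^ 2 := by ring
      _ ≤ C₂ * (3 * ε) ^ 2 := by gcongr
      _ = 9 * C₂ * ε ^ 2 := by ring
  rw [hid, abs_mul, abs_of_pos hcpos, virialK, hdv, ← hεdef]
  calc c * |ε⁻¹ * (1 / 2 * ∑ a, n a * Dψ a) + ⟪Vcm N w i j, omg N w i j⟫_ℝ * (1 / 2 * Dχ)|
      ≤ c * (27 * C₂ * ε ^ 2 + (‖(w i).2‖ + ‖(w j).2‖) * (9 * C₂ * ε ^ 2)) :=
        mul_le_mul_of_nonneg_left ((abs_add_le _ _).trans (add_le_add h1 h2)) hcpos.le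
    _ ≤ c * (27 * C₂ * ε ^ 2 + (‖(w i).2‖ + ‖(w j).2‖) * (27 * C₂ * ε ^ 2)) := by
        gcongr; norm_num
    _ = 27 * C₂ * ε * (ε * c * (1 + ‖(w i).2‖ + ‖(w j).2‖)) := by ring

end OneCollision

/-! ## Summation over the collisions of a good orbit -/

section Orbit

/-- With at least two particles the diameter `ε_N = σ (N+1)^{-1/3}` is `< 1/2` once `σ ≤ 1/2`. -/
theorem hsDiameter_lt_half {σ : ℝ} (hσ : 0 < σ) (hσ2 : σ ≤ 1 / 2) {N : ℕ} (hN : 1 ≤ N) :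
    hsDiameter σ N < 2⁻¹ := by
  have h1 : (1 : ℝ) < ((N + 1 : ℕ) : ℝ) := by exact_mod_cast Nat.lt_succ_of_le hN
  have h2 : ((N + 1 : ℕ) : ℝ) ^ (-(1 / 3 : ℝ)) < 1 :=
    Real.rpow_lt_one_of_one_lt_of_neg h1 (by norm_num)
  calc hsDiameter σ N = σ * ((N + 1 : ℕ) : ℝ) ^ (-(1 / 3 : ℝ)) := rfl
    _ < σ * 1 := mul_lt_mul_of_pos_left h2 hσ
    _ ≤ 2⁻¹ := by rw [mul_one]; norm_num; linarith

/-- **[A'-kin] THE FLUX FORM OF THE JUMP SUM (pathwise).** For `0 < σ ≤ 1/2`, a flow family, a good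
initial datum, tests whose slices on `[0, t]` are smooth with all second space derivatives bounded by
`C₂`, and `τ ∈ [0, t]`: `|J_N(z, τ) − M_N(z, τ)| ≤ 27 C₂ ε_N · V_N(z, τ)` — the crux's collision-jump sum IS
the flux-form mark sum up to `ε_N` times the weighted collision virial (Taylor step, collision by
collision, over the two orders of each colliding pair). -/
theorem abs_Jfun_sub_Mfun_le {σ : ℝ} (hσ : 0 < σ) (hσ2 : σ ≤ 1 / 2) (Φ : Flows σ) {N : ℕ} {z : Cfg N}
    (hz : z ∈ (Φ N).good) {t : ℝ} {ψ : ℝ → T3 → V3} {χ : ℝ → T3 → ℝ} {C₂ : ℝ} (hC₂ : 0 ≤ C₂)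
    (hψ : ∀ s ∈ Icc 0 t, ∀ a, Torus.IsSmooth fun y => ψ s y a)
    (hχ : ∀ s ∈ Icc 0 t, Torus.IsSmooth (χ s))
    (hCψ : ∀ s ∈ Icc 0 t, ∀ a c e y, |Torus.partialDeriv c (Torus.partialDeriv e fun y => ψ s y a) y| ≤ C₂)
    (hCχ : ∀ s ∈ Icc 0 t, ∀ c e y, |Torus.partialDeriv c (Torus.partialDeriv e (χ s)) y| ≤ C₂)
    {τ : ℝ} (hτ : τ ∈ Icc 0 t) :
    |Jfun σ Φ ψ χ N z τ - Mfun σ Φ ψ χ N z τ| ≤ 27 * C₂ * hsDiameter σ N * virialW σ Φ N z τ := by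
  have htraj := (Φ N).isTrajectory z hz
  have hfin := htraj.finite_collisionTimes_inter_Ioc 0 τ
  have hε := hsDiameter_pos hσ N
  set c : ℝ := ((N : ℝ) + 1)⁻¹ with hcdef
  have hc0 : 0 ≤ c := by positivity
  unfold Jfun Mfun virialW HardSphereFlow.collisionPairSum
  rw [collisionPairSum_eq_finset_sum hfin, collisionPairSum_eq_finset_sum hfin,
    collisionPairSum_eq_finset_sum hfin, ← hcdef, ← mul_sub, ← Finset.sum_sub_distrib, abs_mul,
    abs_of_nonneg hc0, mul_comm (27 * C₂ * hsDiameter σ N) (c * _), mul_assoc c, Finset.sum_mul]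
  refine mul_le_mul_of_nonneg_left ((Finset.abs_sum_le_sum_abs _ _).trans
    (Finset.sum_le_sum fun tc htc => ?_)) hc0
  -- one collision time
  have htc' : tc ∈ collisionTimes (Torus.geometry (Fin 3)) (hsDiameter σ N) (fun s => (Φ N).flow s z) ∧
      tc ∈ Ioc 0 τ := (Set.Finite.mem_toFinset hfin).1 htc
  obtain ⟨⟨p, q, hpq, hcs⟩, htcI⟩ := htc'
  have hs : tc ∈ Icc 0 t := ⟨htcI.1.le, htcI.2.trans hτ.2⟩
  -- at least two particles, so `ε_N < 1/2`
  have hN : 1 ≤ N := by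
    rcases Nat.eq_zero_or_pos N with h0 | h0
    · subst h0; exact absurd (Fin.ext (by omega)) hpq
    · exact h0
  have hεhalf := hsDiameter_lt_half hσ hσ2 hN
  -- the two ordered contact pairs
  set w : Cfg N := (Φ N).flow tc z with hw
  have hpq_mem : (p, q) ∈ contactPairs (Torus.geometry (Fin 3)) (hsDiameter σ N) w :=
    mem_contactPairs.2 ⟨hpq, hcs⟩
  have hqp_mem : (q, p) ∈ contactPairs (Torus.geometry (Fin 3)) (hsDiameter σ N) w := by
    refine mem_contactPairs.2 ⟨Ne.symm hpq, hcs.1, ?_⟩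
    rw [Torus.norm_geometry_sepVec, Torus.euclidDist_comm, ← Torus.norm_geometry_sepVec]
    exact hcs.2
  have hpairs : contactPairs (Torus.geometry (Fin 3)) (hsDiameter σ N) w = {(p, q), (q, p)} := by
    ext e
    rw [Finset.mem_insert, Finset.mem_singleton]
    exact ⟨htraj.eq_or_eq_of_mem_contactPairs hpq_mem, by rintro (rfl | rfl) <;> assumption⟩
  have hne : (p, q) ≠ (q, p) := fun he => hpq (Prod.mk.inj he).1
  rw [hpairs, Finset.sum_pair hne, Finset.sum_pair hne, Finset.sum_pair hne]
  -- the Taylor step at this collision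
  have hcontact : ‖sepV N w p q‖ = hsDiameter σ N := hcs.2
  have hout : 0 < ⟪sepV N w p q, (w p).2 - (w q).2⟫_ℝ := htraj.isOutgoing_of_mem_contactSet hpq hcs
  have hstep := abs_pairJump_sub_pairMark_le hcontact hε hεhalf hout (hψ tc hs) (hχ tc hs) (hCψ tc hs)
    (hCχ tc hs)
  refine hstep.trans ?_
  have hK : 0 ≤ 27 * C₂ * hsDiameter σ N := by positivity
  rw [add_mul, mul_comm (virialK σ N tc w p q)]
  exact le_add_of_nonneg_right (mul_nonneg (virialK_nonneg hσ.le N tc w q p) hK)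

/-- The weighted collision virial is monotone in the window (nonnegative kernel, more collision times). -/
theorem virialW_mono {σ : ℝ} (hσ : 0 < σ) (Φ : Flows σ) {N : ℕ} {z : Cfg N} (hz : z ∈ (Φ N).good)
    {τ τ' : ℝ} (hττ' : τ ≤ τ') : virialW σ Φ N z τ ≤ virialW σ Φ N z τ' := by
  have htraj := (Φ N).isTrajectory z hz
  have hfin := htraj.finite_collisionTimes_inter_Ioc 0 τ
  have hfin' := htraj.finite_collisionTimes_inter_Ioc 0 τ'
  unfold virialW HardSphereFlow.collisionPairSum
  rw [collisionPairSum_eq_finset_sum hfin, collisionPairSum_eq_finset_sum hfin']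
  refine mul_le_mul_of_nonneg_left ?_ (by positivity)
  refine Finset.sum_le_sum_of_subset_of_nonneg ?_ fun tc _ _ =>
    Finset.sum_nonneg fun e _ => virialK_nonneg hσ.le N tc _ e.1 e.2
  intro tc htc
  rw [Set.Finite.mem_toFinset] at htc ⊢
  exact ⟨htc.1, htc.2.1, htc.2.2.trans hττ'⟩

end Orbit

/-! ## The reduction [A'] ⟸ [A'-kin] ∧ [V] ∧ [A'-chaos] -/

section Reduction

/-- Uniform second-derivative bounds of the test slices on `[0, t]` (all components of `ψ`, and `χ`). -/
theorem exists_second_deriv_bound {t : ℝ} (ht : 0 < t) {ψ : ℝ → T3 → V3} {χ : ℝ → T3 → ℝ}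
    (hψ : Torus.IsSmoothSpaceTimeOn (Icc 0 t) ψ) (hχ : Torus.IsSmoothSpaceTimeOn (Icc 0 t) χ) :
    ∃ C₂ : ℝ, 0 ≤ C₂ ∧
      (∀ s ∈ Icc 0 t, ∀ a c e y, |Torus.partialDeriv c (Torus.partialDeriv e fun y => ψ s y a) y| ≤ C₂) ∧
      (∀ s ∈ Icc 0 t, ∀ c e y, |Torus.partialDeriv c (Torus.partialDeriv e (χ s)) y| ≤ C₂) := by
  have hU : UniqueDiffOn ℝ (Icc (0 : ℝ) t) := uniqueDiffOn_Icc ht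
  choose Cψ hCψ0 hCψ using fun a : Fin 3 =>
    Torus.exists_hasDerivBounds_of_isSmoothSpaceTimeOn hU isCompact_Icc Subset.rfl 2 (hψ.apply a)
  obtain ⟨Cχ, hCχ0, hCχ⟩ := Torus.exists_hasDerivBounds_of_isSmoothSpaceTimeOn hU isCompact_Icc Subset.rfl 2 hχ
  refine ⟨(∑ a, Cψ a) + Cχ, add_nonneg (Finset.sum_nonneg fun a _ => hCψ0 a) hCχ0, ?_, ?_⟩
  · intro s hs a c e y
    have h := (hCψ a s hs).bound (l := [c, e]) (by simp) y
    simp only [Torus.iterPartialDeriv_cons, Torus.iterPartialDeriv_nil, List.length_cons, List.length_nil,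
      one_pow, mul_one, Real.norm_eq_abs] at h
    refine h.trans (le_add_of_le_of_nonneg ?_ hCχ0)
    exact Finset.single_le_sum (f := fun a => Cψ a) (fun a _ => hCψ0 a) (Finset.mem_univ a)
  · intro s hs c e y
    have h := (hCχ s hs).bound (l := [c, e]) (by simp) y
    simp only [Torus.iterPartialDeriv_cons, Torus.iterPartialDeriv_nil, List.length_cons, List.length_nil,
      one_pow, mul_one, Real.norm_eq_abs] at h
    exact h.trans (le_add_of_nonneg_left (Finset.sum_nonneg fun a _ => hCψ0 a))

/-- **[A'] from its parts.** At fixed `(σ, profiles, Φ, kernel, t, ψ, χ)` with `0 < σ ≤ 1/2` and smooth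
tests on `[0, t]`: virial boundedness in probability [V] and flux-form chaos [A'-chaos] imply the raw
flux-moment chaos [A'] (`J_N − Sraw_N → 0` in probability uniformly in `τ ≤ t`) — by the PROVED flux form
[A'-kin] `|J_N − M_N| ≤ 27 C₂ ε_N V_N` on the good set, `ε_N → 0`, and a union bound. -/
theorem fluxMomentChaos_of_parts : ∀ {σ : ℝ}, 0 < σ → σ ≤ 1 / 2 → ∀ (a₀ θ₀ : T3 → ℝ) (u₀ : T3 → V3) (Φ : Flows σ) (φ : ℕ → T3 → ℝ) {t : ℝ}, 0 < t → ∀ {ψ : ℝ → T3 → V3} {χ : ℝ → T3 → ℝ}, Literature.Analysis.FunctionSpaces.Torus.IsSmoothSpaceTimeOn (Icc 0 t) ψ → Literature.Analysis.FunctionSpaces.Torus.IsSmoothSpaceTimeOn (Icc 0 t) χ → VirialBounded σ a₀ θ₀ u₀ Φ t → FluxFormChaos σ a₀ θ₀ u₀ Φ φ t ψ χ → FluxMomentChaos σ a₀ θ₀ u₀ Φ φ t ψ χ := by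
  intro σ hσ hσ2 a₀ θ₀ u₀ Φ φ t ht ψ χ hψ hχ hV hCh δ hδ
  obtain ⟨C₂, hC₂, hCψ, hCχ⟩ := exists_second_deriv_bound ht hψ hχ
  have hδ2 : 0 < δ / 2 := half_pos hδ
  set P : (N : ℕ) → Measure (Cfg N) := fun N => localGibbsLaw σ a₀ u₀ θ₀ N (Φ N) with hP
  set A : (N : ℕ) → Set (Cfg N) := fun N =>
    {z | ∃ τ ∈ Icc 0 t, δ / 2 < |Mfun σ Φ ψ χ N z τ - Sraw σ Φ φ ψ χ N z τ|} with hA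
  have hAlim : Tendsto (fun N => P N (A N)) atTop (𝓝 0) := hCh (δ / 2) hδ2
  refine ENNReal.tendsto_nhds_zero.2 fun e he => ?_
  -- a real budget `e' ≤ e`, split in two halves
  obtain ⟨e', he'0, he'e⟩ : ∃ e' : ℝ, 0 < e' ∧ ENNReal.ofReal e' ≤ e := by
    rcases eq_or_ne e ⊤ with h | h
    · exact ⟨1, one_pos, h ▸ le_top⟩
    · refine ⟨e.toReal, ENNReal.toReal_pos he.ne' h, ?_⟩
      rw [ENNReal.ofReal_toReal h]
  obtain ⟨K, hK⟩ := hV (e' / 2) (half_pos he'0)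
  set K' : ℝ := max K 1 with hK'
  have hK'0 : 0 < K' := lt_of_lt_of_le one_pos (le_max_right _ _)
  set B : (N : ℕ) → Set (Cfg N) := fun N => {z | K < virialW σ Φ N z t} with hB
  -- eventually `27 C₂ ε_N K' < δ/2`
  have hεlim : Tendsto (fun N : ℕ => 27 * C₂ * hsDiameter σ N * K') atTop (𝓝 0) := by
    have h := ((tendsto_hsDiameter σ).const_mul (27 * C₂)).mul_const K'
    simpa using h
  have h1 : ∀ᶠ N : ℕ in atTop, 27 * C₂ * hsDiameter σ N * K' < δ / 2 := hεlim.eventually (gt_mem_nhds hδ2)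
  have h2 : ∀ᶠ N : ℕ in atTop, P N (A N) ≤ ENNReal.ofReal (e' / 2) :=
    ((tendsto_order.1 hAlim).2 _ (ENNReal.ofReal_pos.2 (half_pos he'0))).mono fun N hN => hN.le
  filter_upwards [h1, h2, hK] with N hN1 hN2 hN3
  -- the union bound at this `N`
  have hcover : {z : Cfg N | ∃ τ ∈ Icc 0 t, δ < |Jfun σ Φ ψ χ N z τ - Sraw σ Φ φ ψ χ N z τ|} ⊆
      (Φ N).goodᶜ ∪ (A N ∪ B N) := by
    rintro z ⟨τ, hτ, hzδ⟩
    by_cases hz : z ∈ (Φ N).good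
    · right
      by_contra hno
      simp only [Set.mem_union, hA, hB, Set.mem_setOf_eq, not_or, not_exists, not_and, not_lt] at hno
      obtain ⟨hnA, hnB⟩ := hno
      have hkin := abs_Jfun_sub_Mfun_le hσ hσ2 Φ hz hC₂
        (fun s hs a => (hψ.isSmooth_slice hs).apply a) (fun s hs => hχ.isSmooth_slice hs) hCψ hCχ hτ
      have hmono : virialW σ Φ N z τ ≤ virialW σ Φ N z t := virialW_mono hσ Φ hz hτ.2
      have hVK : virialW σ Φ N z t ≤ K' := hnB.trans (le_max_left _ _)
      have hcoef : 0 ≤ 27 * C₂ * hsDiameter σ N := by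
        have := hsDiameter_pos hσ N; positivity
      have h1 : |Jfun σ Φ ψ χ N z τ - Mfun σ Φ ψ χ N z τ| ≤ δ / 2 :=
        calc _ ≤ 27 * C₂ * hsDiameter σ N * virialW σ Φ N z τ := hkin
          _ ≤ 27 * C₂ * hsDiameter σ N * K' := mul_le_mul_of_nonneg_left (hmono.trans hVK) hcoef
          _ ≤ δ / 2 := hN1.le
      have h2 := hnA τ hτ
      have htri := abs_sub_le (Jfun σ Φ ψ χ N z τ) (Mfun σ Φ ψ χ N z τ) (Sraw σ Φ φ ψ χ N z τ)
      linarith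
    · exact Or.inl hz
  calc P N {z | ∃ τ ∈ Icc 0 t, δ < |Jfun σ Φ ψ χ N z τ - Sraw σ Φ φ ψ χ N z τ|}
      ≤ P N ((Φ N).goodᶜ ∪ (A N ∪ B N)) := measure_mono hcover
    _ ≤ P N (Φ N).goodᶜ + P N (A N ∪ B N) := measure_union_le _ _
    _ ≤ P N (Φ N).goodᶜ + (P N (A N) + P N (B N)) := add_le_add le_rfl (measure_union_le _ _)
    _ = P N (A N) + P N (B N) := by rw [hP, localGibbsLaw_compl_good' (Φ N), zero_add]
    _ ≤ ENNReal.ofReal (e' / 2) + ENNReal.ofReal (e' / 2) := add_le_add hN2 hN3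
    _ = ENNReal.ofReal e' := by rw [← ENNReal.ofReal_add (by positivity) (by positivity), add_halves]
    _ ≤ e := he'e

end Reduction

end

end Summit.AtomisticToContinuum.HydrodynamicLimit.Theorems.HemisphereAffineSlaving
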